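import Summits.QuantumFields.YangMills.Theorems.InfiniteVolumePerOrderCompactness
import HarnessLib

/-!
# Infinite volume by compactness, STATE-LEVEL engine: compactness and translations for GIVEN states

Support file for `DyadicChessboard.DyadicCalibration` (stmt-QuantumFields-23371).  The landed per-order engines
(`InfiniteVolume.PerOrder*`) consume a per-order TORUS collar bound `(Cn n/R⁴)ⁿ` on odd tori and use it in exactly one way
downstream of the junction: through the inheritance `momentBound_oddTorusLimitPoints`, i.e. as a collar bound for the
centred plane-string weights of the odd-torus limit STATES.  The dyadic route delivers its ceilings on dyadic tori and a
boundary-condition transfer (K2) to particular odd-torus limit states; so this file re-runs the compactness/translation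
statements with (i) the states `μ_k ∈ oddTorusLimitPoints r β_k` GIVEN (not chosen) and (ii) the collar bound ASSUMED
ON THOSE STATES (`ℤ⁴`-separation form).  Everything is verbatim the landed argument, citing the abstract lemmas
(`PerOrder.exists_subseq_limit_of_zdCollar`, `norm_tsum_weight_mul_le`, `translate_eq_of_tendsto`, …) BY NAME.

WHAT IS PROVED ([folklore]; soft analysis): `exists_subseq_limit_state`, `translateMulti_invariant_of_tendsto_state`,
`exists_subseq_limit_translate_state`.

HONEST FRAMING: nothing here is a statement about Bałaban's renormalisation group, reflection positivity, chessboard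
estimates, a mass gap or Clay; the state collar bound is a HYPOTHESIS.  No summit is proved (rung R2a plumbing).
Width seat ym-line-sfw-p2-w2 g23.

References: Glimm–Jaffe (1987) §6.1; Osterwalder–Schrader CMP 42 (1975) §2; Chatterjee arXiv:1803.01950 §2.
-/

set_option autoImplicit false

noncomputable section

open scoped BigOperators SchwartzMap
open MeasureTheory Filter Topology
open Literature.MathematicalPhysics.QuantumFieldTheory hiding ZdEdge
open Literature.MathematicalPhysics.QuantumLattice
open Literature.MathematicalPhysics.AQFT
open Literature.Probability.LatticeModels (box Site)
open Summit.QuantumFields.YangMills.Cruxes.OSLegsFromFemtoAndGap.DlrCollarTransfer (plane)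

namespace Summit.QuantumFields.YangMills.Theorems.InfiniteVolume.PerOrderState

variable {G : Type} [Group G] [TopologicalSpace G] [IsTopologicalGroup G] [CompactSpace G]
  [MeasurableSpace G] [BorelSpace G]

/-- **THE COMPACTNESS STEP FOR GIVEN STATES, per-order constants.**  Couplings `β_k`, spacings `0 < a(β_k) ≤ 1/24`,
`a(β_k) ≤ ℓ₄`, GIVEN odd-torus limit states `μ_k` whose centred plane-string weights obey the per-order `ℤ⁴`-collar
bound `(Cn n/R⁴)ⁿ`; evaluation points `6a`-close to the lattice points.  Then along a subsequence the infinite-volume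
series converge on every `⁰𝒮ₙ` to continuous linear functionals with the explicit E0′ bound (verbatim
`PerOrder.exists_subseq_limit_of_zdCollar`). [folklore] -/
theorem exists_subseq_limit_state (r : LatticeRep G) {a : ℝ → ℝ} (Cn : ℕ → ℝ) {ℓ₄ : ℝ} (hℓ : 0 < ℓ₄)
    (hC : ∀ n, 0 ≤ Cn n) {Cp : ℝ} (hCp : ∀ (q : Fin 4 × Fin 4) (x : Fin 4 → ℤ) (U : LGConfig 4 G), |plane G r q x U| ≤ Cp)
    (β : ℕ → ℝ) (ha : ∀ k, 0 < a (β k)) (ha24 : ∀ k, a (β k) ≤ 1 / 24) (haℓ : ∀ k, a (β k) ≤ ℓ₄)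
    (μ : ℕ → Measure (LGConfig 4 G)) (hμ : ∀ k, μ k ∈ oddTorusLimitPoints r (β k))
    (HW : ∀ (k n : ℕ) (q : Fin n → Fin 4 × Fin 4), (∀ i, (q i).1 < (q i).2) →
      ∀ (x : Fin n → Site 4) (R : ℕ), 1 ≤ R → (R : ℝ) * a (β k) ≤ ℓ₄ →
        (∀ i j : Fin n, i ≠ j → ∃ m : Fin 4, (2 * (R : ℤ) + 4) ≤ |x i m - x j m|) →
        |∫ U, ∏ i, (plane G r (q i) (x i) U - ∫ V, plane G r (q i) (x i) V ∂(μ k)) ∂(μ k)| ≤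
          (Cn n / (R : ℝ) ^ 4) ^ n)
    (y : ℕ → (n : ℕ) → (Fin n → Fin 4 × Fin 4) → (Fin n → Site 4) → (Fin n → EuclideanSpace ℝ (Fin 4)))
    (hy : ∀ k n q x l, ‖y k n q x l - a (β k) • siteToE (x l)‖ ≤ 6 * a (β k)) :
    ∃ φ : ℕ → ℕ, StrictMono φ ∧
      ∃ S : (n : ℕ) → (Fin n → Fin 4 × Fin 4) → (𝓢((Fin n → EuclideanSpace ℝ (Fin 4)), ℂ) →L[ℂ] ℂ),
        (∀ n q F, ‖S n q F‖ ≤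
          5 * ((((Cp + Cp) * 4 ^ 4 * 5 ^ 6 + (Cp + Cp) * 2 ^ 6 * (10 + 2 * 6) ^ 4 +
            16 * Cn n * 2 ^ 6 * (2 / ℓ₄ + 48) ^ 4) * 2 ^ 6 * (81 * ∑' m : ℕ, (((m : ℝ) + 1) ^ 2)⁻¹)) ^ n) *
            schwartzNorm (10 * n) F) ∧
        ∀ n : ℕ, 2 ≤ n → ∀ q : Fin n → Fin 4 × Fin 4, (∀ i, (q i).1 < (q i).2) →
          ∀ F : 𝓢((Fin n → EuclideanSpace ℝ (Fin 4)), ℂ), IsOffDiagonal F →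
            Tendsto (fun j => ∑' x : Fin n → Site 4,
              (((∫ U, ∏ i, (plane G r (q i) (x i) U - ∫ V, plane G r (q i) (x i) V ∂(μ (φ j))) ∂(μ (φ j)) : ℝ)
                : ℂ)) * F (y (φ j) n q x)) atTop (𝓝 (S n q F)) := by
  have hCp0 : 0 ≤ Cp := le_trans (abs_nonneg _) (hCp (0, 1) 0 (fun _ => 1))
  haveI : ∀ k, IsProbabilityMeasure (μ k) := fun k => by
    obtain ⟨S, -, hlim⟩ := hμ k
    exact hlim.1
  obtain ⟨φ, hφ, S, hS, hconv⟩ := PerOrder.exists_subseq_limit_of_zdCollar Cn hℓ hC (by positivity : 0 ≤ Cp + Cp)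
    (fun k => a (β k)) ha ha24 haℓ
    (fun k n q x => ∫ U, ∏ i, (plane G r (q i) (x i) U - ∫ V, plane G r (q i) (x i) V ∂(μ k)) ∂(μ k))
    (fun k n q x => abs_infVolWeight_le r hCp (μ k) q x)
    (fun k n q hq x R hR hRa hsep => HW k n q hq x R hR hRa hsep)
    y hy
  exact ⟨φ, hφ, S, hS, hconv⟩

/-- **TRANSLATION INVARIANCE OF THE LIMIT FOR GIVEN STATES, per-order constants** (verbatim
`PerOrderLarge.translateMulti_invariant_of_tendsto_oddTorusLimitPoints` with the collar bound assumed on the states).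
[folklore] -/
theorem translateMulti_invariant_of_tendsto_state (r : LatticeRep G) {a : ℝ → ℝ} (Cn : ℕ → ℝ) {ℓ₄ : ℝ}
    (hℓ : 0 < ℓ₄) (hC : ∀ n, 0 ≤ Cn n)
    {Cp : ℝ} (hCp : ∀ (q : Fin 4 × Fin 4) (x : Fin 4 → ℤ) (U : LGConfig 4 G), |plane G r q x U| ≤ Cp)
    (β : ℕ → ℝ) (ha : ∀ k, 0 < a (β k)) (ha24 : ∀ k, a (β k) ≤ 1 / 24)
    (haℓ : ∀ k, a (β k) ≤ ℓ₄) (ha0 : Tendsto (fun k => a (β k)) atTop (𝓝 0))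
    (μ : ℕ → Measure (LGConfig 4 G)) (hμ : ∀ k, μ k ∈ oddTorusLimitPoints r (β k))
    (HW : ∀ (k n : ℕ) (q : Fin n → Fin 4 × Fin 4), (∀ i, (q i).1 < (q i).2) →
      ∀ (x : Fin n → Site 4) (R : ℕ), 1 ≤ R → (R : ℝ) * a (β k) ≤ ℓ₄ →
        (∀ i j : Fin n, i ≠ j → ∃ m : Fin 4, (2 * (R : ℤ) + 4) ≤ |x i m - x j m|) →
        |∫ U, ∏ i, (plane G r (q i) (x i) U - ∫ V, plane G r (q i) (x i) V ∂(μ k)) ∂(μ k)| ≤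
          (Cn n / (R : ℝ) ^ 4) ^ n)
    {n : ℕ} (hn : 2 ≤ n) (q : Fin n → Fin 4 × Fin 4) (hq : ∀ i, (q i).1 < (q i).2)
    (o : ℕ → Fin n → EuclideanSpace ℝ (Fin 4)) (ho : ∀ k l, ‖o k l‖ ≤ 5 * a (β k))
    {φ : ℕ → ℕ} (hφ : StrictMono φ) (S : 𝓢((Fin n → EuclideanSpace ℝ (Fin 4)), ℂ) → ℂ)
    (hconv : ∀ F : 𝓢((Fin n → EuclideanSpace ℝ (Fin 4)), ℂ), IsOffDiagonal F →
      Tendsto (fun j => ∑' x : Fin n → Site 4,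
        (((∫ U, ∏ i, (plane G r (q i) (x i) U - ∫ V, plane G r (q i) (x i) V ∂(μ (φ j))) ∂(μ (φ j)) : ℝ) : ℂ)) *
          F (fun l => a (β (φ j)) • siteToE (x l) + o (φ j) l)) atTop (𝓝 (S F)))
    (t : EuclideanSpace ℝ (Fin 4)) (F : 𝓢((Fin n → EuclideanSpace ℝ (Fin 4)), ℂ)) (hF : IsOffDiagonal F) :
    S (translateMulti t F) = S F := by
  have hCp0 : 0 ≤ Cp := le_trans (abs_nonneg _) (hCp (0, 1) 0 (fun _ => 1))
  haveI : ∀ k, IsProbabilityMeasure (μ k) := fun k => by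
    obtain ⟨S', -, hlim⟩ := hμ k
    exact hlim.1
  have ha1 : ∀ k, a (β k) ≤ 1 := fun k => (ha24 k).trans (by norm_num)
  have hsa : ∀ k, 6 * a (β k) ≤ 1 / 4 := fun k => by linarith [ha24 k]
  -- shorthand: weights, evaluation maps
  set W : ℕ → (Fin n → Site 4) → ℝ := fun k x =>
    ∫ U, ∏ i, (plane G r (q i) (x i) U - ∫ V, plane G r (q i) (x i) V ∂(μ k)) ∂(μ k) with hWdef
  set y : ℕ → (Fin n → Site 4) → (Fin n → EuclideanSpace ℝ (Fin 4)) := fun k x l =>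
    a (β k) • siteToE (x l) + o k l with hydef
  have hyx : ∀ k x l, ‖y k x l - a (β k) • siteToE (x l)‖ ≤ 6 * a (β k) := fun k x l => by
    simp only [hydef, add_sub_cancel_left]
    linarith [ho k l, (ha k).le]
  have hWsup : ∀ k x, |W k x| ≤ (Cp + Cp) ^ n := fun k x => abs_infVolWeight_le r hCp (μ k) q x
  have hWcol : ∀ k (x : Fin n → Site 4) (R : ℕ), 1 ≤ R → (R : ℝ) * a (β k) ≤ ℓ₄ →
      (∀ i j : Fin n, i ≠ j → ∃ m : Fin 4, (2 * (R : ℤ) + 4) ≤ |x i m - x j m|) →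
      |W k x| ≤ (Cn n / (R : ℝ) ^ 4) ^ n := fun k x R hR hRa hsep => HW k n q hq x R hR hRa hsep
  -- the functionals along `φ`
  set s : ℕ → 𝓢((Fin n → EuclideanSpace ℝ (Fin 4)), ℂ) → ℂ := fun j F =>
    ∑' x : Fin n → Site 4, ((W (φ j) x : ℝ) : ℂ) * F (y (φ j) x) with hsdef
  have hsum : ∀ j (F : 𝓢((Fin n → EuclideanSpace ℝ (Fin 4)), ℂ)),
      Summable fun x : Fin n → Site 4 => ((W (φ j) x : ℝ) : ℂ) * F (y (φ j) x) := fun j F =>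
    summable_mul_of_bounded (ha (φ j)) (ha1 (φ j)) (hsa (φ j)) (pow_nonneg (by positivity) n) (W (φ j))
      (hWsup (φ j)) F (y (φ j)) (hyx (φ j))
  have hsub : ∀ j (F G' : 𝓢((Fin n → EuclideanSpace ℝ (Fin 4)), ℂ)), IsOffDiagonal F → IsOffDiagonal G' →
      s j (F - G') = s j F - s j G' := fun j F G' _ _ => by
    simp only [hsdef]
    rw [← Summable.tsum_sub (hsum j F) (hsum j G')]
    exact tsum_congr fun x => by simp only [sub_apply]; ring
  set K : ℝ := ((Cp + Cp) * 4 ^ 4 * 5 ^ 6 + (Cp + Cp) * 2 ^ 6 * (10 + 2 * 6) ^ 4 +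
      16 * Cn n * 2 ^ 6 * (2 / ℓ₄ + 48) ^ 4) * 2 ^ 6 * (81 * ∑' m : ℕ, (((m : ℝ) + 1) ^ 2)⁻¹) with hK
  have hbd : ∀ j (F : 𝓢((Fin n → EuclideanSpace ℝ (Fin 4)), ℂ)), IsOffDiagonal F →
      ‖s j F‖ ≤ 5 * K ^ n * schwartzNorm (10 * n) F := fun j F hF =>
    norm_tsum_weight_mul_le hℓ (hC n) (by positivity : 0 ≤ Cp + Cp) (W (φ j)) (hWsup (φ j)) (hWcol (φ j))
      (ha (φ j)) (ha1 (φ j)) (haℓ (φ j)) hn (by norm_num) le_rfl (hsa (φ j)) F hF (y (φ j)) (hyx (φ j))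
  -- lattice vectors approximating `t`, exact invariance along the sequence
  have hv := fun j => exists_latticeVector_near (ha (φ j)) t
  choose v hv using hv
  have hbt : Tendsto (fun j => a (β (φ j)) • siteToE (v j)) atTop (𝓝 t) := by
    have ha0' : Tendsto (fun j => 2 * a (β (φ j))) atTop (𝓝 0) := by
      simpa using (ha0.comp hφ.tendsto_atTop).const_mul 2
    rw [tendsto_iff_norm_sub_tendsto_zero]
    refine squeeze_zero (fun j => norm_nonneg _) (fun j => ?_) ha0'
    rw [norm_sub_rev]; exact hv j
  have hinv : ∀ j (F : 𝓢((Fin n → EuclideanSpace ℝ (Fin 4)), ℂ)), IsOffDiagonal F →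
      s j (translateMulti (a (β (φ j)) • siteToE (v j)) F) = s j F := fun j F _ => by
    simp only [hsdef, hydef]
    exact tsum_weight_mul_translateMulti (W (φ j)) (v j)
      (fun x => infVolWeight_translate_oddTorusLimitPoints r (hμ (φ j)) q x (v j)) _ (o (φ j)) F
  exact translate_eq_of_tendsto s S hsub hbd hconv hbt hinv F hF

/-- **THE COMPACTNESS STEP WITH TRANSLATIONS FOR GIVEN STATES, per-order constants** (verbatim
`PerOrderLarge.exists_subseq_limit_translate_oddTorusLimitPoints` with the collar bound assumed on the given states).
[folklore] -/
theorem exists_subseq_limit_translate_state (r : LatticeRep G) {a : ℝ → ℝ} (Cn : ℕ → ℝ) {ℓ₄ : ℝ}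
    (hℓ : 0 < ℓ₄) (hC : ∀ n, 0 ≤ Cn n)
    {Cp : ℝ} (hCp : ∀ (q : Fin 4 × Fin 4) (x : Fin 4 → ℤ) (U : LGConfig 4 G), |plane G r q x U| ≤ Cp)
    (β : ℕ → ℝ) (ha : ∀ k, 0 < a (β k)) (ha24 : ∀ k, a (β k) ≤ 1 / 24)
    (haℓ : ∀ k, a (β k) ≤ ℓ₄) (ha0 : Tendsto (fun k => a (β k)) atTop (𝓝 0))
    (μ : ℕ → Measure (LGConfig 4 G)) (hμ : ∀ k, μ k ∈ oddTorusLimitPoints r (β k))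
    (HW : ∀ (k n : ℕ) (q : Fin n → Fin 4 × Fin 4), (∀ i, (q i).1 < (q i).2) →
      ∀ (x : Fin n → Site 4) (R : ℕ), 1 ≤ R → (R : ℝ) * a (β k) ≤ ℓ₄ →
        (∀ i j : Fin n, i ≠ j → ∃ m : Fin 4, (2 * (R : ℤ) + 4) ≤ |x i m - x j m|) →
        |∫ U, ∏ i, (plane G r (q i) (x i) U - ∫ V, plane G r (q i) (x i) V ∂(μ k)) ∂(μ k)| ≤
          (Cn n / (R : ℝ) ^ 4) ^ n)
    (o : ℕ → (n : ℕ) → (Fin n → Fin 4 × Fin 4) → Fin n → EuclideanSpace ℝ (Fin 4))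
    (ho : ∀ k n q l, ‖o k n q l‖ ≤ 5 * a (β k)) :
    ∃ φ : ℕ → ℕ, StrictMono φ ∧
      ∃ S : (n : ℕ) → (Fin n → Fin 4 × Fin 4) → (𝓢((Fin n → EuclideanSpace ℝ (Fin 4)), ℂ) →L[ℂ] ℂ),
        (∀ n q F, ‖S n q F‖ ≤
          5 * ((((Cp + Cp) * 4 ^ 4 * 5 ^ 6 + (Cp + Cp) * 2 ^ 6 * (10 + 2 * 6) ^ 4 +
            16 * Cn n * 2 ^ 6 * (2 / ℓ₄ + 48) ^ 4) * 2 ^ 6 * (81 * ∑' m : ℕ, (((m : ℝ) + 1) ^ 2)⁻¹)) ^ n) *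
            schwartzNorm (10 * n) F) ∧
        (∀ n : ℕ, 2 ≤ n → ∀ q : Fin n → Fin 4 × Fin 4, (∀ i, (q i).1 < (q i).2) →
          ∀ F : 𝓢((Fin n → EuclideanSpace ℝ (Fin 4)), ℂ), IsOffDiagonal F →
            Tendsto (fun j => ∑' x : Fin n → Site 4,
              (((∫ U, ∏ i, (plane G r (q i) (x i) U - ∫ V, plane G r (q i) (x i) V ∂(μ (φ j))) ∂(μ (φ j)) : ℝ)
                : ℂ)) * F (fun l => a (β (φ j)) • siteToE (x l) + o (φ j) n q l)) atTop (𝓝 (S n q F))) ∧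
        ∀ n : ℕ, 2 ≤ n → ∀ q : Fin n → Fin 4 × Fin 4, (∀ i, (q i).1 < (q i).2) →
          ∀ (t : EuclideanSpace ℝ (Fin 4)) (F : 𝓢((Fin n → EuclideanSpace ℝ (Fin 4)), ℂ)), IsOffDiagonal F →
            S n q (translateMulti t F) = S n q F := by
  have hy : ∀ k n (q : Fin n → Fin 4 × Fin 4) (x : Fin n → Site 4) l,
      ‖(fun l => a (β k) • siteToE (x l) + o k n q l) l - a (β k) • siteToE (x l)‖ ≤ 6 * a (β k) :=
    fun k n q x l => by
      simp only [add_sub_cancel_left]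
      linarith [ho k n q l, (ha k).le]
  obtain ⟨φ, hφ, S, hS, hconv⟩ := exists_subseq_limit_state r Cn hℓ hC hCp β ha ha24 haℓ μ hμ HW
    (fun k n q x l => a (β k) • siteToE (x l) + o k n q l) hy
  refine ⟨φ, hφ, S, hS, hconv, fun n hn q hq t F hF => ?_⟩
  exact translateMulti_invariant_of_tendsto_state r Cn hℓ hC hCp β ha ha24 haℓ ha0 μ hμ HW hn q hq
    (fun k => o k n q) (fun k l => ho k n q l) hφ (S n q) (hconv n hn q hq) t F hF

end Summit.QuantumFields.YangMills.Theorems.InfiniteVolume.PerOrderState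

end
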